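import Summits.QuantumFields.QCD.Theses.SpectralDefectExtinction
import Summits.QuantumFields.QCD.Theorems.SpectralDefectExtinctionPositivityDeficitLeDefectsRootCount
import Summits.QuantumFields.QCD.Theorems.SpectralDefectExtinctionPositivityDeficitLeDefectsTwist
import Literature.MathematicalPhysics.QuantumFieldTheory.QCDPhaseQuenchedReweighting

/-!
# `PositivityDeficitLeDefects` (item stmt-QuantumFields-8970, support of route `SpectralDefectExtinction`,
# `Summit.QuantumFields.QCD`) — proof

The statement: for every `N_f`, torus side `L ≥ 1`, coupling `β` and bare masses `m_f`,
`(1 − ⟨sign⟩₊)/2 ≤ E₊[Σ_f #{real eigenvalues of D_W(U,0,1) below −m_f}]`, both sides written as quotients of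
Wilson-measure integrals with the phase-quenched weight `∏_f |det D_W(U, m_f, 1)|`.

Proof.
* SIGN ⇒ DEFECT (`one_le_countP_of_re_fermionDet_neg`): `det D_W(U, m, 1)` is real (γ₅-hermiticity, tree
  `fermionDet_wilsonDirac_im_holds`) and equals `χ_{−D₀}(m)`, `D₀ = D_W(U,0,1)`, `χ` the characteristic
  polynomial (`Matrix.eval_charpoly`); the real polynomial `s ↦ Re χ_{−D₀}(s)` is monic of degree `12L⁴`, hence
  eventually positive, so `Re det D_W(U, m, 1) < 0` forces a zero `s₀ > m` (intermediate value theorem), i.e. a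
  real eigenvalue `−s₀ < −m` of `D₀`.  (This configurationwise argument replaces the flow-parity lemma of the
  informal plan; no pairing of complex eigenvalues is needed.)
* POINTWISE (`norm_sub_re_le_two_mul_count_mul_norm`): `|P| − Re P ≤ 2·N·|P|` for `P = ∏_f det D_W(m_f)`,
  `N = Σ_f #{…}`: if all factors have `Re ≥ 0` the left side vanishes, otherwise `N ≥ 1` and `|P| − Re P ≤ 2|P|`.
* INTEGRATE and divide by `Z₊ = ∫ ∏_f|det| dμ_W`.  Two obligations hidden in the Lean statement are discharged by
  the helper files: the defect count is a MEASURABLE function of `U` (…`RootCount`: upper semicontinuity of root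
  counts), so its Bochner integral is not junk; and `Z₊ > 0` for ALL parameters (…`Twist`: the constant diagonal
  twist has `det D_W(U₀, m, 1) ≠ 0` for every real `m`, and the Wilson measure charges open sets, tree
  `integral_norm_det_diracMatrix_pos_of_exists`), so the quotients are not the junk `x/0 = 0` (which would make
  the inequality read `1/2 ≤ 0`).
-/

namespace Summit.QuantumFields.QCD.Theorems.PositivityDeficitLeDefects

open MeasureTheory Filter Topology Polynomial
open Literature.MathematicalPhysics Literature.MathematicalPhysics.QuantumLattice
  Literature.MathematicalPhysics.QuantumFieldTheory Literature.Probability.LatticeModels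
open Matrix Complex Finset

/-! ## The real part of a complex polynomial along the real axis -/

/-- For a complex polynomial `P` there is a real polynomial `q` of no larger degree with
`q(s) = Re P(s)` for real `s` and top coefficient `Re (P.coeff (natDegree P))` (take the real parts of the
coefficients). -/
theorem exists_realPart_poly (P : ℂ[X]) :
    ∃ q : ℝ[X], (∀ s : ℝ, q.eval s = (P.eval (s : ℂ)).re) ∧ q.natDegree ≤ P.natDegree ∧
      q.coeff P.natDegree = (P.coeff P.natDegree).re := by
  set N := P.natDegree with hN
  refine ⟨∑ k ∈ Finset.range (N + 1), Polynomial.C (P.coeff k).re * Polynomial.X ^ k, ?_, ?_, ?_⟩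
  · intro s
    rw [Polynomial.eval_finsetSum, Polynomial.eval_eq_sum_range' (Nat.lt_succ_self N) (s : ℂ),
      Complex.re_sum]
    refine Finset.sum_congr rfl fun k _ => ?_
    rw [Polynomial.eval_mul, Polynomial.eval_C, Polynomial.eval_pow, Polynomial.eval_X,
      ← Complex.ofReal_pow, Complex.re_mul_ofReal]
  · refine Polynomial.natDegree_sum_le_of_forall_le _ _ fun k hk => ?_
    refine (Polynomial.natDegree_C_mul_X_pow_le _ _).trans ?_
    exact Nat.lt_succ_iff.1 (Finset.mem_range.1 hk)
  · rw [Polynomial.finsetSum_coeff]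
    simp only [Polynomial.coeff_C_mul_X_pow]
    rw [Finset.sum_ite_eq, if_pos (Finset.mem_range.2 (Nat.lt_succ_self N))]

/-! ## A negative determinant forces a real eigenvalue of the massless operator below `−m` -/

variable {L : ℕ} [NeZero L]

/-- `det D_W(U, s, 1)` is the value at `s` of the characteristic polynomial of `−D_W(U, 0, 1)`
(`D_W(s) = D_W(0) + s·1`). -/
theorem fermionDet_wilsonDirac_eq_eval_charpoly_neg (U : GaugeConfig 4 L SU3) (s : ℝ) :
    fermionDet (wilsonDirac (fundamentalRep (Fin 3)) U s 1) =
      (-wilsonDirac (fundamentalRep (Fin 3)) U 0 1).charpoly.eval (s : ℂ) := by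
  rw [Matrix.eval_charpoly, sub_neg_eq_add, wilsonDirac_mass_eq_add_scalar _ U s 1, add_comm]

/-- **Sign ⇒ defect, configurationwise.**  If the (real) Wilson determinant at bare mass `m` is negative,
the massless Wilson–Dirac operator `D_W(U, 0, 1)` has a real eigenvalue strictly below `−m` (counted here with
algebraic multiplicity as a root of the characteristic polynomial): `s ↦ Re det D_W(U, s, 1)` is a real monic
polynomial of even degree `12L⁴`, negative at `m` and eventually positive, so it vanishes at some `s₀ > m`, and
then `det D_W(U, s₀, 1) = 0`, i.e. `−s₀` is an eigenvalue of `D_W(U, 0, 1)`. -/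
theorem one_le_countP_of_re_fermionDet_neg (U : GaugeConfig 4 L SU3) (m : ℝ)
    (hneg : (fermionDet (wilsonDirac (fundamentalRep (Fin 3)) U m 1)).re < 0) :
    1 ≤ (wilsonDirac (fundamentalRep (Fin 3)) U 0 1).charpoly.roots.countP
      fun z => z.im = 0 ∧ z.re < -m := by
  classical
  set D₀ := wilsonDirac (fundamentalRep (Fin 3)) U 0 1 with hD₀
  set P : ℂ[X] := (-D₀).charpoly with hP
  -- the real polynomial `q(s) = Re det D_W(U, s, 1)`
  obtain ⟨q, hq, hqdeg, hqtop⟩ := exists_realPart_poly P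
  have hg : ∀ s : ℝ, q.eval s = (fermionDet (wilsonDirac (fundamentalRep (Fin 3)) U s 1)).re := fun s => by
    rw [hq, fermionDet_wilsonDirac_eq_eval_charpoly_neg]
  have hPdeg : P.natDegree = Fintype.card (TorusSite 4 L × Fin 3 × Fin 4) :=
    Matrix.charpoly_natDegree_eq_dim _
  have hPmonic : P.Monic := Matrix.charpoly_monic _
  have hqN : q.coeff P.natDegree = 1 := by
    rw [hqtop, hPmonic.coeff_natDegree, Complex.one_re]
  have hqnat : q.natDegree = P.natDegree :=
    Polynomial.natDegree_eq_of_le_of_coeff_ne_zero hqdeg (by rw [hqN]; exact one_ne_zero)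
  have hq0 : q ≠ 0 := fun h => by rw [h, Polynomial.coeff_zero] at hqN; exact zero_ne_one hqN
  have hqlead : q.leadingCoeff = 1 := by rw [Polynomial.leadingCoeff, hqnat, hqN]
  have hqdegpos : 0 < q.degree := by
    rw [Polynomial.degree_eq_natDegree hq0, hqnat, hPdeg]
    exact_mod_cast Fintype.card_pos
  -- eventually positive: a point `s₁ > m` with `q(s₁) ≥ 0`
  have htend := Polynomial.tendsto_atTop_of_leadingCoeff_nonneg q hqdegpos (by rw [hqlead]; exact zero_le_one)
  obtain ⟨s₁, hs₁m, hs₁⟩ : ∃ s₁, m < s₁ ∧ 0 ≤ q.eval s₁ := by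
    have hev := (htend.eventually_ge_atTop 0).and (eventually_gt_atTop m)
    obtain ⟨s₁, h0, h1⟩ := hev.exists
    exact ⟨s₁, h1, h0⟩
  -- intermediate value theorem on `[m, s₁]`
  have hqm : q.eval m < 0 := by rw [hg]; exact hneg
  obtain ⟨s₀, hs₀mem, hs₀⟩ : ∃ s₀ ∈ Set.Icc m s₁, q.eval s₀ = 0 :=
    intermediate_value_Icc hs₁m.le q.continuous.continuousOn ⟨hqm.le, hs₁⟩
  have hs₀m : m < s₀ := by
    rcases eq_or_lt_of_le hs₀mem.1 with h | h
    · exfalso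
      rw [h, hs₀] at hqm
      exact lt_irrefl _ hqm
    · exact h
  -- so `det D_W(U, s₀, 1) = 0` and `−s₀` is a real root of `charpoly D₀` below `−m`
  have hdet : fermionDet (wilsonDirac (fundamentalRep (Fin 3)) U s₀ 1) = 0 := by
    apply Complex.ext
    · rw [← hg, hs₀, Complex.zero_re]
    · rw [fermionDet_wilsonDirac_im_holds (fundamentalRep (Fin 3)) (fun g => fundamentalRep_mem_unitaryGroup g)
        U s₀ 1, Complex.zero_im]
  have hroot : (-(s₀ : ℂ)) ∈ D₀.charpoly.roots := by
    rw [Polynomial.mem_roots (Matrix.charpoly_monic D₀).ne_zero, Polynomial.IsRoot.def, Matrix.eval_charpoly]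
    have h1 : Matrix.scalar (TorusSite 4 L × Fin 3 × Fin 4) (-(s₀ : ℂ)) - D₀ =
        -(wilsonDirac (fundamentalRep (Fin 3)) U s₀ 1) := by
      rw [wilsonDirac_mass_eq_add_scalar _ U s₀ 1, map_neg]
      abel
    rw [h1, Matrix.det_neg]
    change _ * fermionDet (wilsonDirac (fundamentalRep (Fin 3)) U s₀ 1) = 0
    rw [hdet, mul_zero]
  exact Multiset.countP_pos.2 ⟨-(s₀ : ℂ), hroot, by simp, by simp [hs₀m]⟩

/-! ## The pointwise inequality `|P| − Re P ≤ 2·N·|P|` -/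

/-- **Pointwise bound.**  For every gauge field, with `P = ∏_f det D_W(U, m_f, 1)` and `N` the total number of
real eigenvalues of `D_W(U, 0, 1)` below the `−m_f`:  `∏_f |det| − Re P ≤ 2 · N · ∏_f |det|`.  If every factor
has non-negative real part then (all factors being real) `Re P = ∏_f |det|` and the left side vanishes; otherwise
some factor is negative, `N ≥ 1` (`one_le_countP_of_re_fermionDet_neg`) and `−Re P ≤ |P|`. -/
theorem norm_sub_re_le_two_mul_count_mul_norm {Nf : ℕ} (U : GaugeConfig 4 L SU3) (mq : Fin Nf → ℝ) :
    (∏ f : Fin Nf, ‖fermionDet (wilsonDirac (fundamentalRep (Fin 3)) U (mq f) 1)‖) -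
        (∏ f : Fin Nf, fermionDet (wilsonDirac (fundamentalRep (Fin 3)) U (mq f) 1)).re ≤
      2 * ((∑ f : Fin Nf, ((wilsonDirac (fundamentalRep (Fin 3)) U 0 1).charpoly.roots.countP
          (fun z : ℂ => z.im = 0 ∧ z.re < -mq f) : ℝ)) *
        ∏ f : Fin Nf, ‖fermionDet (wilsonDirac (fundamentalRep (Fin 3)) U (mq f) 1)‖) := by
  classical
  set det : Fin Nf → ℂ := fun f => fermionDet (wilsonDirac (fundamentalRep (Fin 3)) U (mq f) 1) with hdet
  have him : ∀ f, (det f).im = 0 := fun f =>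
    fermionDet_wilsonDirac_im_holds (fundamentalRep (Fin 3)) (fun g => fundamentalRep_mem_unitaryGroup g) U (mq f) 1
  have hreal : ∀ f, det f = (((det f).re : ℝ) : ℂ) := fun f => Complex.ext (by simp) (by simp [him f])
  have hA0 : 0 ≤ ∏ f, ‖det f‖ := Finset.prod_nonneg fun f _ => norm_nonneg _
  have hN0 : (0 : ℝ) ≤ ∑ f : Fin Nf, ((wilsonDirac (fundamentalRep (Fin 3)) U 0 1).charpoly.roots.countP
      (fun z : ℂ => z.im = 0 ∧ z.re < -mq f) : ℝ) := Finset.sum_nonneg fun f _ => Nat.cast_nonneg _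
  by_cases h : ∃ f, (det f).re < 0
  · -- a negative factor: at least one defect, and `|P| − Re P ≤ 2|P|`
    obtain ⟨f₀, hf₀⟩ := h
    have h1 : (1 : ℝ) ≤ ((wilsonDirac (fundamentalRep (Fin 3)) U 0 1).charpoly.roots.countP
        (fun z : ℂ => z.im = 0 ∧ z.re < -mq f₀) : ℝ) := by
      exact_mod_cast one_le_countP_of_re_fermionDet_neg U (mq f₀) hf₀
    have hN1 : (1 : ℝ) ≤ ∑ f : Fin Nf, ((wilsonDirac (fundamentalRep (Fin 3)) U 0 1).charpoly.roots.countP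
        (fun z : ℂ => z.im = 0 ∧ z.re < -mq f) : ℝ) :=
      h1.trans (Finset.single_le_sum (f := fun f => ((wilsonDirac (fundamentalRep (Fin 3)) U 0 1).charpoly.roots.countP
        (fun z : ℂ => z.im = 0 ∧ z.re < -mq f) : ℝ)) (fun f _ => Nat.cast_nonneg _) (Finset.mem_univ f₀))
    have hre : -(∏ f, det f).re ≤ ∏ f, ‖det f‖ := by
      rw [← norm_prod]
      exact (neg_le_abs _).trans (Complex.abs_re_le_norm _)
    nlinarith [hre, hA0, hN1]
  · -- all factors non-negative: `Re P = ∏ |det|`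
    push Not at h
    have hP : (∏ f, det f).re = ∏ f, ‖det f‖ := by
      have h1 : ∏ f, det f = (((∏ f, (det f).re : ℝ)) : ℂ) := by
        rw [Complex.ofReal_prod]
        exact Finset.prod_congr rfl fun f _ => hreal f
      rw [h1, Complex.ofReal_re]
      refine Finset.prod_congr rfl fun f _ => ?_
      rw [hreal f, Complex.norm_real, Real.norm_eq_abs, Complex.ofReal_re, abs_of_nonneg (h f)]
    rw [hP, sub_self]
    exact mul_nonneg zero_le_two (mul_nonneg hN0 hA0)

/-! ## The theorem -/

/-- **`PositivityDeficitLeDefects`** (support item stmt-QuantumFields-8970 of route `SpectralDefectExtinction`):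
for every `N_f`, torus side `L ≥ 1`, coupling `β` and bare masses `m_f`,
`(1 − ⟨sign⟩₊)/2 ≤ E₊[Σ_f #{real eigenvalues of D_W(U,0,1) below −m_f}]`.  Integrate the pointwise bound
`norm_sub_re_le_two_mul_count_mul_norm` against the Wilson measure (the count is measurable,
`measurable_countP_charpoly_roots_real_lt`; all integrands are bounded) and divide by
`Z₊ = ∫ ∏_f |det D_W(m_f)| dμ_W > 0` (`exists_gaugeConfig_forall_fermionDet_ne_zero` and
`integral_norm_det_diracMatrix_pos_of_exists`). -/
theorem positivityDeficitLeDefects_proof :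
    Summit.QuantumFields.QCD.Theses.SpectralDefectExtinction.PositivityDeficitLeDefects := by
  intro Nf L _ β mq
  classical
  set μ := wilsonMeasure (d := 4) (L := L) (fundamentalRep (Fin 3)) β with hμ
  -- abbreviations for the three integrands
  set A : GaugeConfig 4 L SU3 → ℝ := fun U =>
    ∏ f : Fin Nf, ‖fermionDet (wilsonDirac (fundamentalRep (Fin 3)) U (mq f) 1)‖ with hA
  set R : GaugeConfig 4 L SU3 → ℝ := fun U =>
    (∏ f : Fin Nf, fermionDet (wilsonDirac (fundamentalRep (Fin 3)) U (mq f) 1)).re with hR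
  set N : GaugeConfig 4 L SU3 → ℝ := fun U =>
    ∑ f : Fin Nf, ((wilsonDirac (fundamentalRep (Fin 3)) U 0 1).charpoly.roots.countP
      (fun z : ℂ => z.im = 0 ∧ z.re < -mq f) : ℝ) with hN
  change (1 - (∫ U, R U ∂μ) / (∫ U, A U ∂μ)) / 2 ≤ (∫ U, N U * A U ∂μ) / (∫ U, A U ∂μ)
  -- `A = |det diracMatrix|`, `R = Re det diracMatrix`
  have hAeq : A = fun U => ‖(diracMatrix U mq).det‖ := funext fun U => (norm_det_diracMatrix U mq).symm
  have hReq : R = fun U => ((diracMatrix U mq).det).re := funext fun U => by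
    simp only [hR, det_diracMatrix]
  -- positivity of the normalisation
  have hZ : 0 < ∫ U, A U ∂μ := by
    rw [hAeq]
    obtain ⟨U₀, hU₀⟩ := exists_gaugeConfig_forall_fermionDet_ne_zero (L := L)
    refine integral_norm_det_diracMatrix_pos_of_exists β mq ⟨U₀, ?_⟩
    rw [det_diracMatrix]
    exact Finset.prod_ne_zero_iff.2 fun f _ => hU₀ (mq f)
  -- integrability
  have hAi : Integrable A μ := by rw [hAeq]; exact integrable_norm_det_diracMatrix mq μ
  have hA0 : ∀ U, 0 ≤ A U := fun U => Finset.prod_nonneg fun f _ => norm_nonneg _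
  have hRi : Integrable R μ := by
    refine hAi.mono' ?_ (Eventually.of_forall fun U => ?_)
    · rw [hReq]
      exact (Complex.continuous_re.comp (continuous_det_diracMatrix mq)).aestronglyMeasurable
    · rw [hReq, hAeq, Real.norm_eq_abs]
      exact Complex.abs_re_le_norm _
  have hNm : Measurable N := by
    refine Finset.measurable_sum _ fun f _ => ?_
    exact (measurable_from_nat (f := (Nat.cast : ℕ → ℝ))).comp
      (measurable_countP_charpoly_roots_real_lt
        (continuous_wilsonDirac (fundamentalRep (Fin 3)) (continuous_fundamentalRep (Fin 3)) 0 1) (-mq f))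
  have hN0 : ∀ U, 0 ≤ N U := fun U => Finset.sum_nonneg fun f _ => Nat.cast_nonneg _
  have hNle : ∀ U, N U ≤ Nf * Fintype.card (TorusSite 4 L × Fin 3 × Fin 4) := by
    intro U
    have hle : ∀ f : Fin Nf, ((wilsonDirac (fundamentalRep (Fin 3)) U 0 1).charpoly.roots.countP
        (fun z : ℂ => z.im = 0 ∧ z.re < -mq f) : ℝ) ≤ Fintype.card (TorusSite 4 L × Fin 3 × Fin 4) := by
      intro f
      have h1 := Multiset.countP_le_card (fun z : ℂ => z.im = 0 ∧ z.re < -mq f)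
        (wilsonDirac (fundamentalRep (Fin 3)) U 0 1).charpoly.roots
      have h2 := Polynomial.card_roots' (wilsonDirac (fundamentalRep (Fin 3)) U 0 1).charpoly
      rw [Matrix.charpoly_natDegree_eq_dim] at h2
      exact_mod_cast h1.trans h2
    calc N U ≤ ∑ _f : Fin Nf, (Fintype.card (TorusSite 4 L × Fin 3 × Fin 4) : ℝ) := Finset.sum_le_sum fun f _ => hle f
      _ = Nf * Fintype.card (TorusSite 4 L × Fin 3 × Fin 4) := by
        rw [Finset.sum_const, Finset.card_univ, Fintype.card_fin, nsmul_eq_mul]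
  have hNAi : Integrable (fun U => N U * A U) μ := by
    refine (hAi.const_mul (Nf * Fintype.card (TorusSite 4 L × Fin 3 × Fin 4))).mono'
      (hNm.aestronglyMeasurable.mul hAi.aestronglyMeasurable) (Eventually.of_forall fun U => ?_)
    rw [Real.norm_eq_abs, abs_of_nonneg (mul_nonneg (hN0 U) (hA0 U))]
    exact mul_le_mul_of_nonneg_right (hNle U) (hA0 U)
  -- integrate the pointwise bound
  have hpt : ∀ U, A U - R U ≤ 2 * (N U * A U) := fun U => norm_sub_re_le_two_mul_count_mul_norm U mq
  have hint : (∫ U, A U ∂μ) - ∫ U, R U ∂μ ≤ 2 * ∫ U, N U * A U ∂μ := by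
    rw [← integral_sub hAi hRi, ← integral_const_mul]
    exact integral_mono (hAi.sub hRi) (hNAi.const_mul 2) hpt
  -- divide by `Z₊ > 0`
  rw [le_div_iff₀ hZ]
  have key : (1 - (∫ U, R U ∂μ) / ∫ U, A U ∂μ) / 2 * ∫ U, A U ∂μ = ((∫ U, A U ∂μ) - ∫ U, R U ∂μ) / 2 := by
    field_simp
  rw [key]
  linarith

end Summit.QuantumFields.QCD.Theorems.PositivityDeficitLeDefects
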